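import Summits.BirchSwinnertonDyer.Rank1Residual.X9.PrintCertBridge
import Summits.BirchSwinnertonDyer.Rank1Residual.Additive.IntModelTamagawaCertificateLocal
import Literature.NumberTheory.EllipticCurves.NoEverywhereGoodReductionRat
import Literature.NumberTheory.EllipticCurves.RootNumberProofs
import Literature.NumberTheory.DiophantineGeometry.ConductorExponentZeroProofs
import Literature.NumberTheory.DiophantineGeometry.ConductorFactorizationProofs
import HarnessLib

/-!
# Leaves X9 / X10b — per-pair certificate records: KERNEL TAMAGAWA CERTIFICATES (records v2, tool file)

HONEST FRAMING (cell `bsd-print-x9`, D-0131 (2) print tier; partition leaves `ClassX9` and `ClassX10 ∧ ¬Surj`):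
theorems, one data structure and three plumbing definitions; no named fact; nothing is asserted about any
elliptic curve beyond what the kernel rechecks; no leaf is claimed closed (`BSDpOnClassX9`, `BSDpOnClassX10b`
stay `@[conjecture]`). Companion of `X9/PrintCertSchema.lean` (the record), `X9/PrintCertBridge.lean`
(`Record.intCurve`, `Record.curve`) and of the rank-2 observatory's Tate-algorithm certificate stack
(`Theorems/Rank2ObservatoryTamagawa{Local,Cert,ExactCert,KernelCert}.lean`: `TamLocal` / `TamX` / `TamZ`, ONE
soundness theorem per stage, NO named fact) bridged to globally minimal `W / ℚ` by
`Additive/IntModelTamagawaCertificate{,Local}.lean` (cell `b2b-bsdres`).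

WHY (route `PrintX9`, crux J = item 20392 `HeegnerDivisibilityX9`): J asks `p^s`-divisibility of derived Heegner
points for `s ≤ t = ord_p ∏_ℓ c_ℓ(E/ℚ)`. On the sub-locus `p ∤ ∏ c_ℓ` it is VACUOUS and the leaf closes from
print + rung K6's two items (`pPartBSD_of_classX9_of_not_dvd_tamagawa_of_integralMainConjectureOnClassX9`,
binder `htam0 : ¬ p ∣ W.tamagawaProduct`); its BC3 skeleton splits the rest by whether ONE bad prime `q`
carries the whole depth (`padicValNat p W.tamagawaProduct ≤ padicValNat p (c(W/ℚ_q))`, Jetchev's regime) or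
not (multi-prime regime). The v1 records carry `∏ c_q` and the local `c_q` only as Cremona/PARI/stdlib-Tate
DATA (shape-checked, not recomputed). This file makes them KERNEL FACTS per pair:

* `TamCert` = a row certificate `(Es, Xs, Zs)` of the observatory's three stages; `Record.tamCheck r c` (decidable):
  the row certificate checks ON THE RECORD'S INTEGRAL MODEL `r.intCurve`, every local value set is a singleton,
  the kernel value `rowValueZ` IS the record's `tamagawa`, and the kernel local values ARE the record's
  `(q, c_q)` list, in order;
* for ANY globally minimal `W / ℚ` with `integralModelInt W = r.intCurve` (display files: `W = r.curve`,
  `hI = r.integralModelInt_curve`): `Record.tamagawaProduct_eq_of_tamCheck : W.tamagawaProduct = r.tamagawa`,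
  `Record.localTamagawaNumber_eq_of_tamCheck : c(W/ℚ_[q]) = c_q` over Mathlib's `ℤ_[q]` at every listed `q`
  (and `= 1` at unlisted primes), `Record.dvd_conductorNorm_of_tamCheck : q ∣ N(W)` at every listed `q`;
* the three J-regime consumers: `Record.not_dvd_tamagawaProduct_of_tamCheck` (VACUOUS: `¬ p ∣ ∏ c_ℓ`, the
  `htam0` binder), `Record.exists_carrier_of_tamCheck` (SINGLE CARRIER: the literal hypothesis of the case split
  `HeegnerDivisibilityX9_of` of the BC3 skeleton), `Record.padicValNat_tamagawaProduct_of_tamCheck` (the depth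
  `t` as a kernel numeral);
* the slice walker `tamWalk records certs` (one `decide +kernel` per display file `X9/PrintCertTamagawa*.lean`)
  and its unpacking `tamagawaProduct_eq_of_tamWalk` / `exists_tamCheck_of_tamWalk`.
Census of the 1103 landed records (engine run `gen/tamcert.py` of seat ty3 gen 2; engine 1 = the observatory's
`tam.py`/`tamx.py`/`tamz.py` reused unchanged, engines P/T = the records' PARI `elllocalred` / stdlib-Tate local
data, 3291 bad primes, 0 disagreements): X9 790 = vacuous 627 + single-carrier 158 + multi-prime 5; X10b 313 =
160 + 92 + 61.

References: J. Tate, LNM 476 (1975) §7 [Tate1975]; J. H. Silverman, *Advanced Topics*, GTM 151 (1994) IV.9.4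
[Silverman1994]; J. H. Silverman, *AEC* 2nd ed. (2009) VII.1 Prop. 1.3(b), VII.6 Ex. 7.6, VIII.8, VIII.11
[SilvermanAEC2009]; J. E. Cremona, *Algorithms for Modular Elliptic Curves* (1997) §3.2 [CremonaAlgorithms1997];
D. Jetchev, Compos. Math. 144 (2008) Thm. 1.1 [Jetchev2008].
-/

set_option autoImplicit false

open scoped NumberField
open WeierstrassCurve IsDedekindDomain
open Summit.BirchSwinnertonDyer.BirchSwinnertonDyer.Rank2Observatory.Tam
open Summit.BirchSwinnertonDyer.Rank1Residual.Additive
open Summit.BirchSwinnertonDyer.BirchSwinnertonDyer.Rank1Residual.IntModel (minimalDiscriminantInt_eq)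

namespace Summit.BirchSwinnertonDyer.Rank1Residual.X9.PrintCert

/-! ### Bad primes divide the conductor (bookkeeping, for the carrier statement) -/

/-- A prime of BAD reduction divides the conductor: `f_ℓ = 0 ↔` good reduction (Silverman *ATAEC* IV.10.2(a),
tree theorems `conductorExponent_eq_zero_iff_holds`, `factorization_conductorNorm_holds`,
`hasGoodReductionAtPrime_iff_hasGoodReductionAt_holds`) — the contrapositive bookkeeping of the tree's
`not_dvd_conductorNorm_of_hasGoodReductionAtPrime`. [cite: Silverman1994, IV.10.2(a)] -/
theorem dvd_conductorNorm_of_not_hasGoodReductionAtPrime (W : WeierstrassCurve ℚ) [W.IsElliptic] {ℓ : ℕ}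
    [hℓ : Fact ℓ.Prime] (h : ¬ W.HasGoodReductionAtPrime ℓ) : ℓ ∣ W.conductorNorm ℤ := by
  by_contra hN
  set v : HeightOneSpectrum ℤ := (Rat.HeightOneSpectrum.primesEquiv (R := ℤ)).symm ⟨ℓ, hℓ.out⟩ with hv
  have hgen : Rat.HeightOneSpectrum.natGenerator v = ℓ :=
    congrArg Subtype.val ((Rat.HeightOneSpectrum.primesEquiv (R := ℤ)).apply_symm_apply ⟨ℓ, hℓ.out⟩)
  have hfac : (W.conductorNorm ℤ).factorization ℓ = 0 := Nat.factorization_eq_zero_of_not_dvd hN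
  have hf : W.conductorExponent v = 0 := by
    rw [← W.factorization_conductorNorm_holds v, hgen, hfac]
  exact h ((W.hasGoodReductionAtPrime_iff_hasGoodReductionAt_holds ⟨ℓ, hℓ.out⟩).mpr
    ((WeierstrassCurve.conductorExponent_eq_zero_iff_holds v W).mp hf))

/-! ### The Tamagawa row certificate of a record and its kernel check -/

/-- A TAMAGAWA ROW CERTIFICATE for a record: the observatory's stage-1 local certificates `Es : List TamLocal`
(one per bad prime, increasing), the exact supplements `Xs : List TamX` (Kodaira `IV` / `IV*`) and
`Zs : List TamZ` (`I₀*` / `Iₙ*`). Data only. [cite: Silverman1994, IV.9.4] -/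
structure TamCert where
  /-- stage 1: one `TamLocal` per bad prime -/
  Es : List TamLocal
  /-- stage 2: exact certificates at the primes of type `IV` / `IV*` -/
  Xs : List TamX
  /-- stage 3: kernel certificates at the primes of type `I₀*` / `Iₙ*` -/
  Zs : List TamZ
  deriving Repr, DecidableEq, Inhabited

namespace TamCert

variable (c : TamCert)

/-- The kernel value of the Tamagawa product carried by the certificate (`TamZ.rowValueZ`). [folklore] -/
def value : ℕ := TamZ.rowValueZ c.Es c.Xs c.Zs

/-- The kernel local values `(q, c_q)`: at each listed prime the head of its sharpened value set. [folklore] -/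
def locals : List (ℕ × ℕ) := c.Es.map fun E => (E.p, (TamZ.valsZ c.Zs c.Xs E).headD 1)

end TamCert

namespace Record

variable (r : Record)

/-- The KERNEL CHECK of a Tamagawa certificate against a record: the row certificate checks on the record's
integral model `r.intCurve` (every `TamLocal` / `TamX` / `TamZ` checks, primes distinct, `|Δ| = ∏ qⁿ`), every
sharpened local value set is a singleton, the kernel product IS `r.tamagawa`, and the kernel local values ARE
the record's `(q, c_q)` list `bad`, in order. [cite: Silverman1994, IV.9.4] -/
def tamCheck (c : TamCert) : Bool :=
  TamZ.rowCheckZ c.Es c.Xs c.Zs r.intCurve && TamZ.rowExactZ c.Es c.Xs c.Zs &&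
    decide (c.value = r.tamagawa) && decide (c.locals = r.bad.map fun t => (t.1, t.2.2.2))

/-- The single-carrier witness of a record: the first listed bad prime `q` whose `c_q` absorbs the whole
`p`-adic Tamagawa depth, `ord_p ∏ c_ℓ ≤ ord_p c_q` (read on the record's data; `none` in the vacuous and in the
multi-prime regime alike — use `¬ p ∣ tamagawa` to tell those apart). [cite: Jetchev2008, Thm. 1.1] -/
def singleCarrier : Option ℕ :=
  ((r.bad.find? fun t => decide (0 < padicValNat r.p r.tamagawa ∧
    padicValNat r.p r.tamagawa ≤ padicValNat r.p t.2.2.2)).map fun t => t.1)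

variable {r}

/-- Unpacking a passing Tamagawa check. [folklore] -/
theorem tamCheck_spec {c : TamCert} (h : r.tamCheck c = true) :
    TamZ.rowCheckZ c.Es c.Xs c.Zs r.intCurve = true ∧ TamZ.rowExactZ c.Es c.Xs c.Zs = true ∧
      c.value = r.tamagawa ∧ c.locals = r.bad.map fun t => (t.1, t.2.2.2) := by
  simp only [tamCheck, Bool.and_eq_true, decide_eq_true_eq] at h
  exact ⟨h.1.1.1, h.1.1.2, h.1.2, h.2⟩

/-- The stage-1 row check inside a passing Tamagawa check. [folklore] -/
theorem rowCheck_of_tamCheck {c : TamCert} (h : r.tamCheck c = true) :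
    TamLocal.rowCheck c.Es r.intCurve = true := by
  have h1 := (tamCheck_spec h).1
  simp only [TamZ.rowCheckZ, TamX.rowCheckX, Bool.and_eq_true] at h1
  exact h1.1.1

/-- A listed prime of a passing certificate is prime. [folklore] -/
theorem prime_of_mem_locals {c : TamCert} (h : r.tamCheck c = true) {q cq : ℕ} (hq : (q, cq) ∈ c.locals) :
    q.Prime := by
  obtain ⟨E, hE, hEq⟩ := List.mem_map.mp hq
  obtain ⟨rfl, -⟩ := Prod.mk.inj hEq
  exact TamLocal.prime_of_mem_map (rowCheck_of_tamCheck h) (List.mem_map.mpr ⟨E, hE, rfl⟩)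

/-! ### Kernel discharges for any globally minimal `W` with the record's integral model -/

section Discharge

variable {W : WeierstrassCurve ℚ} [W.IsGloballyMinimal] (hI : integralModelInt W = r.intCurve)
include hI

/-- **`∏_ℓ c_ℓ(W) = r.tamagawa` IN THE KERNEL** for any globally minimal `W / ℚ` with the record's integral
model, from a passing Tamagawa check (Tate's algorithm certificates, all local values exact).
[cite: Silverman1994, IV.9.4] [cite: Tate1975, §7] -/
theorem tamagawaProduct_eq_of_tamCheck {c : TamCert} (h : r.tamCheck c = true) :
    W.tamagawaProduct = r.tamagawa := by
  obtain ⟨hrow, hex, hval, -⟩ := tamCheck_spec h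
  rw [IntModelTam.tamagawaProduct_eq_rowValueZ_of_intModel hI hrow hex]
  exact hval

/-- **The Tamagawa depth as a kernel numeral**: `ord_q ∏_ℓ c_ℓ(W) = ord_q r.tamagawa` (any `q`; at `q = p`
this is crux J's depth `t`). [cite: Silverman1994, IV.9.4] -/
theorem padicValNat_tamagawaProduct_of_tamCheck {c : TamCert} (h : r.tamCheck c = true) (q : ℕ) :
    padicValNat q W.tamagawaProduct = padicValNat q r.tamagawa := by
  rw [tamagawaProduct_eq_of_tamCheck hI h]

/-- **J-VACUOUS pairs**: if the record's `tamagawa` is prime to `p` (decidable on the data) then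
`¬ p ∣ ∏_ℓ c_ℓ(W)` — the binder `htam0` of
`pPartBSD_of_classX9_of_not_dvd_tamagawa_of_integralMainConjectureOnClassX9`, IN THE KERNEL (free prime `q`,
`hq : q = r.p`, so that literal `3` / `5` / `7` fit). [cite: Silverman1994, IV.9.4] -/
theorem not_dvd_tamagawaProduct_of_tamCheck {c : TamCert} (h : r.tamCheck c = true)
    (hp : ¬ r.p ∣ r.tamagawa) {q : ℕ} (hq : q = r.p) : ¬ q ∣ W.tamagawaProduct := by
  rw [tamagawaProduct_eq_of_tamCheck hI h, hq]
  exact hp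

/-- **The local Tamagawa number over Mathlib's `ℤ_[q]` IN THE KERNEL**: at every prime `q` listed by a passing
certificate, `c(W / ℚ_[q]) = c_q`, the certificate's exact value (Tate's algorithm; transport
`localTamagawaNumber_padic_eq_holds` from the place of `𝓞 ℚ` to `ℚ_[q]`).
[cite: Silverman1994, IV.9.4] [cite: SilvermanAEC2009, VII.6 Ex. 7.6] -/
theorem localTamagawaNumber_eq_of_tamCheck [W.IsElliptic] {c : TamCert} (h : r.tamCheck c = true)
    {q cq : ℕ} [hq' : Fact q.Prime] (hq : (q, cq) ∈ c.locals) :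
    (W.baseChange ℚ_[q]).localTamagawaNumber ℤ_[q] = cq := by
  obtain ⟨hrow, hex, -, -⟩ := tamCheck_spec h
  obtain ⟨E, hE, hEq⟩ := List.mem_map.mp hq
  obtain ⟨hp, hc⟩ := Prod.mk.inj hEq
  have hGM : (r.intCurve.baseChange ℚ).IsGloballyMinimal :=
    IntModelTam.eq_baseChange_of_integralModelInt hI ▸ ‹_›
  have hmem := TamZ.tam_mem_valsZ_of_mem hrow hGM hE (pl q) ((natGenerator_pl hq'.out).trans hp.symm)
  have h1 : (TamZ.valsZ c.Zs c.Xs E).length = 1 := by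
    simpa using List.all_eq_true.mp hex E hE
  obtain ⟨a, ha⟩ := List.length_eq_one_iff.mp h1
  rw [ha, List.mem_singleton] at hmem
  rw [ha] at hc
  simp only [List.headD_cons] at hc
  rw [IntModelTam.localTamagawaNumber_padic_eq_tam_of_intModel hI q, hmem, hc]

/-- **The local Tamagawa number at a prime of the record's `bad` list IN THE KERNEL**: for
`(q, f_q, v_q(Δ), c_q) ∈ r.bad`, `c(W / ℚ_[q]) = c_q`. [cite: Silverman1994, IV.9.4] -/
theorem localTamagawaNumber_eq_of_tamCheck_of_mem_bad [W.IsElliptic] {c : TamCert} (h : r.tamCheck c = true)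
    {t : ℕ × ℕ × ℕ × ℕ} (ht : t ∈ r.bad) [Fact t.1.Prime] :
    (W.baseChange ℚ_[t.1]).localTamagawaNumber ℤ_[t.1] = t.2.2.2 := by
  refine localTamagawaNumber_eq_of_tamCheck hI h ?_
  rw [(tamCheck_spec h).2.2.2]
  exact List.mem_map.mpr ⟨t, ht, rfl⟩

/-- **`c(W / ℚ_[q]) = 1` at every prime NOT listed** by a passing certificate (`q ∤ Δ_min`: good reduction).
[cite: SilvermanAEC2009, VII.5 Prop. 5.1(a)] -/
theorem localTamagawaNumber_eq_one_of_tamCheck [W.IsElliptic] {c : TamCert} (h : r.tamCheck c = true)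
    {q : ℕ} [hq' : Fact q.Prime] (hq : q ∉ c.Es.map (·.p)) :
    (W.baseChange ℚ_[q]).localTamagawaNumber ℤ_[q] = 1 := by
  have hrow := rowCheck_of_tamCheck h
  haveI : (r.intCurve.baseChange ℚ).IsElliptic := TamLocal.isElliptic_of_rowCheck hrow
  rw [IntModelTam.localTamagawaNumber_padic_eq_tam_of_intModel hI q]
  exact TamLocal.tam_eq_one_of_not_mem hrow (pl q) (by rwa [natGenerator_pl hq'.out])

/-- **Listed primes divide the conductor**: a prime `q` listed by a passing certificate has `q ∣ Δ(r.intCurve)`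
`= Δ_min(W)` (exact valuation `qⁿ ∥ Δ`, `n ≥ 1`), so `W` has bad reduction at `q` and `q ∣ N(W)`.
[cite: SilvermanAEC2009, VIII.11 (primes of bad reduction divide the conductor)] -/
theorem dvd_conductorNorm_of_tamCheck [W.IsElliptic] {c : TamCert} (h : r.tamCheck c = true)
    {q cq : ℕ} [hq' : Fact q.Prime] (hq : (q, cq) ∈ c.locals) : q ∣ W.conductorNorm ℤ := by
  obtain ⟨E, hE, hEq⟩ := List.mem_map.mp hq
  obtain ⟨hp, -⟩ := Prod.mk.inj hEq
  obtain ⟨-, hn, ⟨hdvd, -⟩, -⟩ :=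
    TamLocal.check_common ((TamLocal.rowCheck_spec (rowCheck_of_tamCheck h)).1 E hE)
  refine dvd_conductorNorm_of_not_hasGoodReductionAtPrime W
    (not_hasGoodReductionAtPrime_of_dvd_minimalDiscriminantInt W q ?_)
  rw [minimalDiscriminantInt_eq hI, ← hp]
  exact (dvd_pow_self _ (by omega)).trans hdvd

/-- **SINGLE-CARRIER pairs**: if the record names a carrier `q₀` (`singleCarrier = some q₀`: a listed bad prime
with `0 < ord_p ∏ c_ℓ ≤ ord_p c_{q₀}` on the data), then — IN THE KERNEL — there is a prime `q ∣ N(W)` with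
`ord_p ∏_ℓ c_ℓ(W) ≤ ord_p c(W / ℚ_[q])`: literally the hypothesis under which the BC3 skeleton
`HeegnerDivisibilityX9_of` routes the pair to Jetchev's single-prime stub (free prime `p`, `hp : p = r.p`).
[cite: Jetchev2008, Thm. 1.1] [cite: Silverman1994, IV.9.4] -/
theorem exists_carrier_of_tamCheck [W.IsElliptic] {c : TamCert} (h : r.tamCheck c = true) {q₀ : ℕ}
    (hs : r.singleCarrier = some q₀) {p : ℕ} (hp : p = r.p) :
    ∃ (q : ℕ) (_ : Fact q.Prime), q ∣ W.conductorNorm ℤ ∧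
      padicValNat p W.tamagawaProduct ≤ padicValNat p ((W.baseChange ℚ_[q]).localTamagawaNumber ℤ_[q]) := by
  subst hp
  obtain ⟨t, ht, rfl⟩ := Option.map_eq_some_iff.mp hs
  have htmem : t ∈ r.bad := List.mem_of_find?_eq_some ht
  have hle := List.find?_some ht
  simp only [decide_eq_true_eq] at hle
  have hloc : (t.1, t.2.2.2) ∈ c.locals := by
    rw [(tamCheck_spec h).2.2.2]; exact List.mem_map.mpr ⟨t, htmem, rfl⟩
  haveI : Fact t.1.Prime := ⟨prime_of_mem_locals h hloc⟩
  refine ⟨t.1, inferInstance, dvd_conductorNorm_of_tamCheck hI h hloc, ?_⟩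
  rw [padicValNat_tamagawaProduct_of_tamCheck hI h, localTamagawaNumber_eq_of_tamCheck hI h hloc]
  exact hle.2

end Discharge

/-! ### The record's own curve (`W = r.curve`; minimality from `Record.isGloballyMinimal_curve_of_krausCheck`
or as an instance hypothesis) -/

/-- `∏_ℓ c_ℓ(r.curve) = r.tamagawa` for the record's own (globally minimal) model. [cite: Silverman1994, IV.9.4] -/
theorem tamagawaProduct_curve_of_tamCheck [r.curve.IsGloballyMinimal] {c : TamCert} (h : r.tamCheck c = true) :
    r.curve.tamagawaProduct = r.tamagawa :=
  tamagawaProduct_eq_of_tamCheck r.integralModelInt_curve h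

end Record

/-! ### Slice walker: records and certificates side by side -/

/-- One pass over a display list of records and the list of their Tamagawa certificates (same order): every
record's certificate passes `Record.tamCheck`, and the lists have the same length. [folklore] -/
def tamWalk : List Record → List TamCert → Bool
  | [], [] => true
  | r :: rs, c :: cs => r.tamCheck c && tamWalk rs cs
  | [], _ :: _ => false
  | _ :: _, [] => false

/-- What a passing walk says about each listed record: some listed certificate passes its check. [folklore] -/
theorem exists_tamCheck_of_tamWalk :
    ∀ {rs : List Record} {cs : List TamCert}, tamWalk rs cs = true →
      ∀ r ∈ rs, ∃ c ∈ cs, r.tamCheck c = true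
  | [], [], _, r, hr => by simp at hr
  | [], _ :: _, h, _, _ => by simp [tamWalk] at h
  | _ :: _, [], h, _, _ => by simp [tamWalk] at h
  | r' :: rs, c :: cs, h, r, hr => by
    simp only [tamWalk, Bool.and_eq_true] at h
    rcases List.mem_cons.mp hr with rfl | hr'
    · exact ⟨c, List.mem_cons_self, h.1⟩
    · obtain ⟨c', hc', hcheck⟩ := exists_tamCheck_of_tamWalk h.2 r hr'
      exact ⟨c', List.mem_cons_of_mem _ hc', hcheck⟩

/-- **Display form**: after a passing walk, every listed record's Tamagawa product is its `tamagawa` field IN THE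
KERNEL, for any globally minimal `W` with the record's integral model. [cite: Silverman1994, IV.9.4] -/
theorem tamagawaProduct_eq_of_tamWalk {rs : List Record} {cs : List TamCert} (h : tamWalk rs cs = true)
    {r : Record} (hr : r ∈ rs) {W : WeierstrassCurve ℚ} [W.IsGloballyMinimal]
    (hI : integralModelInt W = r.intCurve) : W.tamagawaProduct = r.tamagawa := by
  obtain ⟨c, -, hc⟩ := exists_tamCheck_of_tamWalk h r hr
  exact Record.tamagawaProduct_eq_of_tamCheck hI hc

/-- **Display form, J-vacuous pairs**: after a passing walk, a listed record with `¬ p ∣ tamagawa` gives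
`¬ p ∣ ∏_ℓ c_ℓ(W)` IN THE KERNEL. [cite: Silverman1994, IV.9.4] -/
theorem not_dvd_tamagawaProduct_of_tamWalk {rs : List Record} {cs : List TamCert} (h : tamWalk rs cs = true)
    {r : Record} (hr : r ∈ rs) (hp : ¬ r.p ∣ r.tamagawa) {W : WeierstrassCurve ℚ} [W.IsGloballyMinimal]
    (hI : integralModelInt W = r.intCurve) {q : ℕ} (hq : q = r.p) : ¬ q ∣ W.tamagawaProduct := by
  obtain ⟨c, -, hc⟩ := exists_tamCheck_of_tamWalk h r hr
  exact Record.not_dvd_tamagawaProduct_of_tamCheck hI hc hp hq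

/-- **Display form, single-carrier pairs**: after a passing walk, a listed record with a named carrier gives the
single-prime hypothesis of `HeegnerDivisibilityX9_of` IN THE KERNEL. [cite: Jetchev2008, Thm. 1.1] -/
theorem exists_carrier_of_tamWalk {rs : List Record} {cs : List TamCert} (h : tamWalk rs cs = true)
    {r : Record} (hr : r ∈ rs) {q₀ : ℕ} (hs : r.singleCarrier = some q₀) {W : WeierstrassCurve ℚ}
    [W.IsElliptic] [W.IsGloballyMinimal] (hI : integralModelInt W = r.intCurve) {p : ℕ} (hp : p = r.p) :
    ∃ (q : ℕ) (_ : Fact q.Prime), q ∣ W.conductorNorm ℤ ∧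
      padicValNat p W.tamagawaProduct ≤ padicValNat p ((W.baseChange ℚ_[q]).localTamagawaNumber ℤ_[q]) := by
  obtain ⟨c, -, hc⟩ := exists_tamCheck_of_tamWalk h r hr
  exact Record.exists_carrier_of_tamCheck hI hc hs hp

/-! ### Kernel self-tests: the schema's sample record `2268b1 @ 5` (J-vacuous) and `6897c1 @ 5` (multi-prime) -/

-- `decide` unfolds trial division, Tate translations and the record's point counts: raise the recursion depth.
set_option maxRecDepth 100000

/-- The Tamagawa certificate of `2268b1 = [0, 0, 0, -1161, 16389]` (`Δ = −2⁴·3¹⁰·7⁵`): `2` of type `IV` after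
`(r, s, t) = (1, 0, 1)` — exact by `TamX` (no root of the Step-5 quadratic on `(1, 1, 1) • W`: `c₂ = 1`), `3` of
type `IV*` after `(6, 0, 0)` — exact by `TamX` (no root: `c₃ = 1`), `7` of type `I₅` NON-split by the Euler
witness (`c₇ = 1`): `∏ c_ℓ = 1` (Cremona: `1`). [cite: Silverman1994, IV.9.4] [cite: CremonaAlgorithms1997, Table 1] -/
def tamCert_2268b1 : TamCert :=
  ⟨[⟨2, 1, 4, 0, 1, 0, 1, 4, 4, 2, 1⟩, ⟨3, 1, 5, 0, 6, 0, 0, 10, 8, 0, 1⟩, ⟨7, 2, 3, 0, 0, 0, 0, 5, 0, 0, 1⟩],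
    [⟨2, 1, 2, 1, 1, 1, 4, 0⟩, ⟨3, 1, 4, 6, 0, 0, 10, 0⟩], []⟩

/-- The sample record of the schema (`2268b1 @ 5`, `X9/PrintCertSchema.lean`) PASSES the Tamagawa check with
`tamCert_2268b1` — kernel evaluation. [folklore] -/
theorem tamCheck_2268b1 : Record.tamCheck
    { label := "2268b1", ainvs := [0, 0, 0, -1161, 16389], conductor := 2268, p := 5, imageType := .s4,
      image := "5S4", galrep := ["5S4"], imageCert := some (-43, 7),
      bad := [(2, 2, 4, 1), (3, 4, 10, 1), (7, 1, 5, 1)], kodaira := ["IV", "IV*", "I5"], ap := -2, nP := 8,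
      irrWitness := (11, -1), isogDegrees := [1], rank := 0, rootNumber := 1, torsion := 1, tamagawa := 1,
      shaAn := 1, x0 := (1, 1), muAn := 0, lambdaAn := 0, lpLevel := 2, heegner := [], schneider := none,
      partners := [], engines := ["B:x9-g9 j079989", "C:x9-g9 j079996"], notes := "sample" }
    tamCert_2268b1 = true := by
  decide +kernel

/-- **`∏_ℓ c_ℓ (2268b1) = 1` and `5 ∤ ∏_ℓ c_ℓ` IN THE KERNEL** for any globally minimal `W / ℚ` with integral
model `[0, 0, 0, -1161, 16389]` (a J-vacuous X9 pair). [cite: Silverman1994, IV.9.4] [cite: CremonaAlgorithms1997, Table 1] -/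
theorem tamagawaProduct_2268b1 {W : WeierstrassCurve ℚ} [W.IsGloballyMinimal]
    (hI : integralModelInt W = ⟨0, 0, 0, -1161, 16389⟩) : W.tamagawaProduct = 1 ∧ ¬ 5 ∣ W.tamagawaProduct := by
  have h := Record.tamagawaProduct_eq_of_tamCheck (W := W) (by rw [hI]; rfl) tamCheck_2268b1
  exact ⟨h, by rw [h]; decide⟩

/-- The Tamagawa certificate of `6897c1 = [0, 1, 1, -7817, -272101]` (`N = 3·11²·19`, `Δ = 3⁵·11³·19⁵`): `3` of type
`I₅` SPLIT (root witness `2`, `c₃ = 5`), `11` of type `III` (`c₁₁ = 2`), `19` of type `I₅` SPLIT (root witness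
`10`, `c₁₉ = 5`): `∏ c_ℓ = 50`, `ord₅ = 2` carried by NO single prime — one of the 5 X9 pairs in the multi-prime
regime of crux J. [cite: Silverman1994, IV.9.4] [cite: CremonaAlgorithms1997, Table 1] -/
def tamCert_6897c1 : TamCert :=
  ⟨[⟨3, 1, 1, 2, 0, 0, 0, 5, 0, 0, 5⟩, ⟨11, 3, 4, 0, 7, 0, 5, 3, 3, 2, 2⟩, ⟨19, 4, 1, 10, 0, 0, 0, 5, 0, 0, 5⟩],
    [], []⟩

/-- The landed record of `6897c1 @ 5` (slice `Ns5A`, verbatim: rank `1`, `t = ord₅ ∏ c_ℓ = 2`, Heegner index of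
record `m = 100`, `v₅(m) = 2`). [cite: Cremona2006, Table 1 (curve 6897c1)] -/
def record_6897c1 : Record :=
  { label := "6897c1", ainvs := [0, 1, 1, -7817, -272101], conductor := 6897, p := 5, imageType := .ns5, image :=
    "5Ns", galrep := ["5Ns"], imageCert := some (-2, 3), bad := [(3, 1, 5, 5), (11, 2, 3, 2), (19, 1, 5, 5)],
    kodaira := ["I5", "III", "I5"], ap := 2, nP := 4, irrWitness := (7, 0), isogDegrees := [1], rank := 1,
    rootNumber := -1, torsion := 1, tamagawa := 50, shaAn := 1, x0 := (0, 1), muAn := 0, lambdaAn := 3, lpLevel :=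
    3, heegner := [(-116, 100, 2)], schneider := none, partners := [], engines :=
    ["B:x9-g9 msengine-stabilised modular symbols n=3 lambda=3 (j079989-93)",
    "C:x9-g9 exact twisted L-values level 2 v=3 (j079996-99,j080122)",
    "P:print-x9-ty3 j279831 PARI ellglobalred/ellap/nfroots", "T:print-x9-ty3 tate_stdlib sha16 ed9e5fd9f5f0080a"],
    notes := "x9-g9 fold route OTHER-twoTam; MU-ALL two_engine=1" }

/-- `record_6897c1` PASSES the Tamagawa check with `tamCert_6897c1`, and names NO single carrier (`ord₅ 50 = 2`,
`ord₅ c₃ = ord₅ c₁₉ = 1`) — kernel evaluation. [folklore] -/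
theorem tamCheck_6897c1 : record_6897c1.tamCheck tamCert_6897c1 = true ∧ record_6897c1.singleCarrier = none ∧
    5 ∣ record_6897c1.tamagawa := by
  refine ⟨by decide +kernel, by decide +kernel, by decide⟩

/-- **`∏_ℓ c_ℓ (6897c1) = 50`, `c(W/ℚ₃) = 5`, `c(W/ℚ₁₉) = 5`, `c(W/ℚ₅) = 1` IN THE KERNEL** for any globally minimal
elliptic `W / ℚ` with integral model `[0, 1, 1, -7817, -272101]`. [cite: Silverman1994, IV.9.4] [cite: CremonaAlgorithms1997, Table 1] -/
theorem tamagawaProduct_6897c1 {W : WeierstrassCurve ℚ} [W.IsElliptic] [W.IsGloballyMinimal]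
    (hI : integralModelInt W = ⟨0, 1, 1, -7817, -272101⟩) :
    haveI : Fact (Nat.Prime 3) := ⟨Nat.prime_three⟩
    haveI : Fact (Nat.Prime 19) := ⟨by norm_num⟩
    haveI : Fact (Nat.Prime 5) := ⟨by norm_num⟩
    W.tamagawaProduct = 50 ∧ (W.baseChange ℚ_[3]).localTamagawaNumber ℤ_[3] = 5 ∧
      (W.baseChange ℚ_[19]).localTamagawaNumber ℤ_[19] = 5 ∧ (W.baseChange ℚ_[5]).localTamagawaNumber ℤ_[5] = 1 := by
  haveI : Fact (Nat.Prime 19) := ⟨by norm_num⟩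
  haveI : Fact (Nat.Prime 5) := ⟨by norm_num⟩
  have hI' : integralModelInt W = record_6897c1.intCurve := by rw [hI]; rfl
  exact ⟨Record.tamagawaProduct_eq_of_tamCheck hI' tamCheck_6897c1.1,
    Record.localTamagawaNumber_eq_of_tamCheck_of_mem_bad hI' tamCheck_6897c1.1 (t := (3, 1, 5, 5)) (by decide),
    Record.localTamagawaNumber_eq_of_tamCheck_of_mem_bad hI' tamCheck_6897c1.1 (t := (19, 1, 5, 5)) (by decide),
    Record.localTamagawaNumber_eq_one_of_tamCheck hI' tamCheck_6897c1.1 (by decide)⟩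

end Summit.BirchSwinnertonDyer.Rank1Residual.X9.PrintCert
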